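import Literature.NumberTheory.Automorphic.StableSubmoduleLattice
import Literature.NumberTheory.Automorphic.KimExteriorSquareGL4
import HarnessLib

/-!
# The automorphic representation generated by an automorphic form; eigenforms give Satake parameters

Topic `NumberTheory/Automorphic`; theorems only (no `sorry`, no definition, no named fact), filed in
support of the named fact `Kim2003_exteriorSquare_GL4` (`KimExteriorSquareGL4.lean`; H. H. Kim,
J. Amer. Math. Soc. **16** (2003), Thm. A p. 139 = Thm. 4.2.3 p. 156 / Thm. 5.3.1 p. 165
[Kim2002]) as the **packaging half** of its discharge.

Every proof of a lifting statement in the tree's `GL_n` vocabulary — the conclusion is always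
"there is an automorphic representation datum `P : AutomorphicRepData (AutomorphyDatum.gl N F _)`
with prescribed Satake parameters `P.HasSatakeParamAt v β_v` at almost every `v`" (Kim's `∧²`,
`GelbartJacquet_adjoint_lift`, `ArthurClozel1989_weakLifting_cuspidal`, …) — ends with the same
representation-theoretic step, independent of how the automorphic *forms* were produced (converse
theorem, Eisenstein series and residues, trace formula): from a non-zero automorphic form `φ` on
`GL_N(𝔸_F)`, invariant under a level `K(𝔫)` and a Hecke eigenform at the places `v ∤ 𝔫` in
question, manufacture an automorphic representation `P = W / W'` in the sense of Borel–Jacquet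
(1979), 4.6 (an irreducible subquotient of the space of automorphic forms) in which `φ` survives
(`φ ∈ W ∖ W'`), so that the Hecke eigenvalues of `φ` are Satake parameters of `P`
(`AutomorphicRepData.HasSatakeParamAt`: a `K(𝔫)`-fixed form in `W ∖ W'` which is a Hecke
eigenvector *modulo `W'`*). This is the algebraic half of Langlands' remark that the
`(𝔤, K_∞) × G(𝔸_f)`-module generated by an automorphic form has irreducible (sub)quotients
(Langlands 1979, *On the notion of an automorphic representation*, proof of Prop. 2;
Borel–Jacquet 1979, 4.6), and it is proved here for every automorphy datum:

* `IsStableSubmodule.exists_automorphicRepData_of_mem` — **the automorphic representation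
  generated by a form.** For a stable space `V` of automorphic forms and `0 ≠ φ ∈ V` there is an
  automorphic representation datum `P` with `P.W` the stable closure of `φ` (the smallest stable
  subspace containing `φ`, `StableBelow.closure`), `φ ∈ P.W ∖ P.W'`. Proof: in the complete
  lattice `StableBelow 𝒟 W` of stable subspaces of `W = closure φ` (accepted
  `StableSubmoduleLattice`) the top is the compact element `closure φ`
  (`StableBelow.isCompactElement_closure`), so the lattice is coatomic (Mathlib
  `CompleteLattice.coatomic_of_top_compact` — "a finitely generated module has a maximal proper
  submodule"); a coatom `M` is a maximal proper stable subspace, `W / M` is irreducible, and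
  `φ ∉ M` since `M ≠ W = closure φ`.
* `AutomorphicRepData.hasSatakeParamAt_of_eigenvector` — a `K(𝔫)`-fixed genuine Hecke
  eigenvector `φ ∈ W ∖ W'` of the `t_{v,i}`, `v ∤ 𝔫 ≠ 0`, with eigenvalues
  `q_v^{i(n-i)/2} e_i(α)` exhibits the Satake parameter `α` (definitional: `T φ - c φ = 0 ∈ W'`).
* `IsStableSubmodule.exists_automorphicRepData_hasSatakeParamAt_of_eigenvector` — both combined,
  for `GL_n`: one datum `P ∋ φ` carrying, at every `v ∤ 𝔫`, every Hecke eigen-system of `φ` as a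
  Satake parameter.
* `Kim2003_exteriorSquare_GL4.clause_one_of_eigenform` — **the first clause of Kim's Theorem A
  from an eigenform**: if some stable space of automorphic forms on `GL₆(𝔸_F)` contains a non-zero
  `K(𝔫)`-invariant form `φ` whose `t_{v,i}`-eigenvalues at almost every `v` are
  `q_v^{i(6-i)/2} e_i(∧² α)` whenever `π` has Satake parameter `α` at `v`, then the weak exterior
  square lift of `π` exists in the sense of the fact (`P.HasSatakeParamAt v (wedgeTwoParams α)`
  a.e.). What remains of `Kim2003_exteriorSquare_GL4_holds` after this file is exactly the
  analytic existence of such a `φ` (Kim 2003, §§2–4: the converse theorem of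
  Cogdell–Piatetski-Shapiro fed by the Langlands–Shahidi `L`-functions `L(s, σ ⊗ π, ρ_m ⊗ ∧²ρ₄)`)
  and the isobaric clause (Jacquet–Shalika's classification (4.1), p. 154), neither of which has a
  carrier in the tree yet.
* `Kim2003_exteriorSquare_GL4.conclusion_of_cuspidal_eigenform` — **both clauses from a cuspidal
  eigenform**: if moreover the stable space consists of cusp forms (`V ≤ 𝒜₀`), the representation
  generated by `φ` is cuspidal and the isobaric clause (ii) holds trivially with `k = 1`,
  `σ₁ = P` — the generic case "`∧²π` cuspidal" of Theorem A (Kim 2003, Thm. 4.2.3 with `k = 1`),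
  so that there the whole conclusion of the fact is reduced to the existence of a cuspidal Hecke
  eigenform on `GL₆(𝔸_F)` with the eigenvalues of `∧² t_{π,v}`.

## References

* R. P. Langlands, *On the notion of an automorphic representation*, Proc. Sympos. Pure Math. 33
  (Corvallis 1977), Part 1 (1979), 203–207: Prop. 2 and its proof [LanglandsCorvallis1979Notion].
* A. Borel, H. Jacquet, *Automorphic forms and automorphic representations*, ibid., 189–202,
  §4.6 [BorelJacquet1979].
* H. H. Kim, *Functoriality for the exterior square of `GL₄` and the symmetric fourth of `GL₂`*,
  J. Amer. Math. Soc. 16 (2003), 139–183: Thm. 2.1 (p. 143), Thm. 4.2.3 (p. 156), (4.1) (p. 154)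
  [Kim2002].
-/

open scoped MatrixGroups Matrix ContDiff Classical

open NumberField IsDedekindDomain Filter

noncomputable section

namespace Literature.NumberTheory.Automorphic

/-! ### 1. The automorphic representation generated by a form (any automorphy datum) -/

section General

variable {K : Type} [Field K] [NumberField K]
  {A : Type*} [NormedCommRing A] [NormedAlgebra ℝ A] [NormedAlgebra ℚ A] [CompleteSpace A]
  [StarRing A] {N : Type*} [Fintype N] [DecidableEq N]
  {𝒢 : AdelicGroupData K} {𝒟 : AutomorphyDatum 𝒢 A N}

/-- **The automorphic representation generated by an automorphic form** (Langlands 1979, proof of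
Prop. 2; Borel–Jacquet 1979, 4.6). Let `V` be a `(𝔤, K_∞) × G(𝔸_f)`-stable space of automorphic
forms and `0 ≠ φ ∈ V`. Then there is an automorphic representation datum `P = W / W'` with `W`
the stable closure of `φ` in `V` — so `φ ∈ W ≤ V` and `W ≤ S` for every stable `S ∋ φ` — and
`φ ∉ W'`: the module generated by `φ` is a compact element of the lattice of stable subspaces,
hence has a maximal proper stable subspace `W'` (Mathlib `CompleteLattice.coatomic_of_top_compact`),
and `W / W'` is irreducible.
[cite: LanglandsCorvallis1979Notion, proof of Prop. 2] [cite: BorelJacquet1979, 4.6] -/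
theorem IsStableSubmodule.exists_automorphicRepData_of_mem {V : Submodule ℂ (𝒢.Adelic → ℂ)}
    (hV : IsStableSubmodule 𝒟 V) {φ : 𝒢.Adelic → ℂ} (hφ : φ ∈ V) (hφ0 : φ ≠ 0) :
    ∃ P : AutomorphicRepData 𝒟, φ ∈ P.W ∧ φ ∉ P.W' ∧ P.W ≤ V ∧
      ∀ S : Submodule ℂ (𝒢.Adelic → ℂ), IsStableSubmodule 𝒟 S → φ ∈ S → P.W ≤ S := by
  haveI : Fact (IsStableSubmodule 𝒟 V) := ⟨hV⟩
  -- the stable closure `C` of `φ` in `V` and its minimality among all stable subspaces containing `φ`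
  set C : StableBelow 𝒟 V := StableBelow.closure φ with hCdef
  have hφC : φ ∈ C.1 := StableBelow.mem_closure hφ
  have hCmin : ∀ S : Submodule ℂ (𝒢.Adelic → ℂ), IsStableSubmodule 𝒟 S → φ ∈ S → C.1 ≤ S := by
    intro S hS hφS
    have h : C ≤ StableBelow.mk (S ⊓ V) (hS.inf hV) inf_le_right :=
      StableBelow.closure_le (Submodule.mem_inf.mpr ⟨hφS, hφ⟩)
    exact (StableBelow.le_iff.mp h).trans inf_le_left
  -- the lattice of stable subspaces of `C`; its top is the compact element `closure φ`
  haveI hCfact : Fact (IsStableSubmodule 𝒟 C.1) := ⟨C.2.1⟩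
  have htop : (StableBelow.closure φ : StableBelow 𝒟 C.1) = ⊤ := by
    refine le_antisymm le_top ?_
    rw [StableBelow.le_iff, StableBelow.coe_top]
    exact hCmin _ (StableBelow.closure φ : StableBelow 𝒟 C.1).2.1 (StableBelow.mem_closure hφC)
  have hcompact : IsCompactElement (⊤ : StableBelow 𝒟 C.1) := by
    rw [← htop]
    exact StableBelow.isCompactElement_closure hφC
  haveI : IsCoatomic (StableBelow 𝒟 C.1) := CompleteLattice.coatomic_of_top_compact hcompact
  -- `⊥ ≠ ⊤` there, since `0 ≠ φ ∈ C`
  have hbt : (⊥ : StableBelow 𝒟 C.1) ≠ ⊤ := by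
    intro h
    have h' : (⊥ : Submodule ℂ (𝒢.Adelic → ℂ)) = C.1 := by
      simpa only [StableBelow.coe_bot, StableBelow.coe_top] using congrArg Subtype.val h
    have hφbot : φ ∈ (⊥ : Submodule ℂ (𝒢.Adelic → ℂ)) := by
      rw [h']
      exact hφC
    exact hφ0 ((Submodule.mem_bot ℂ).mp hφbot)
  -- a coatom `M`: a maximal proper stable subspace of `C`
  obtain ⟨M, hM, -⟩ := (eq_top_or_exists_le_coatom (⊥ : StableBelow 𝒟 C.1)).resolve_left hbt
  have hφM : φ ∉ M.1 := by
    intro hφM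
    have h : (StableBelow.closure φ : StableBelow 𝒟 C.1) ≤ M := StableBelow.closure_le hφM
    rw [htop, top_le_iff] at h
    exact hM.1 h
  refine ⟨{ W := C.1
            W' := M.1
            lt := lt_of_le_of_ne M.2.2 fun h => hφM (by rw [h]; exact hφC)
            stable := C.2.1
            stable' := M.2.1
            irreducible := fun W'' h₁ h₂ hst => ?_ }, hφC, hφM, C.2.2, hCmin⟩
  -- irreducibility of `C / M`: a stable `W''` between `M` and `C` is `M` or `C` since `M` is a coatom
  rcases eq_or_ne (StableBelow.mk W'' hst h₂ : StableBelow 𝒟 C.1) M with h | h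
  · exact Or.inl (by simpa only [StableBelow.coe_mk] using congrArg Subtype.val h)
  · refine Or.inr ?_
    have hlt : M < (StableBelow.mk W'' hst h₂ : StableBelow 𝒟 C.1) :=
      lt_of_le_of_ne (StableBelow.le_iff.mpr (by simpa only [StableBelow.coe_mk] using h₁)) h.symm
    simpa only [StableBelow.coe_mk, StableBelow.coe_top] using congrArg Subtype.val (hM.2 _ hlt)

/-- A non-zero automorphic form lying in some stable space of automorphic forms lies in `W ∖ W'`
for some automorphic representation datum `W / W'` (Borel–Jacquet 1979, 4.6: "an irreducible
subquotient of the space of automorphic forms" through `φ`). [cite: BorelJacquet1979, 4.6] -/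
theorem IsStableSubmodule.exists_automorphicRepData_mem_not_mem {V : Submodule ℂ (𝒢.Adelic → ℂ)}
    (hV : IsStableSubmodule 𝒟 V) {φ : 𝒢.Adelic → ℂ} (hφ : φ ∈ V) (hφ0 : φ ≠ 0) :
    ∃ P : AutomorphicRepData 𝒟, φ ∈ P.W ∧ φ ∉ P.W' ∧ P.W ≤ V := by
  obtain ⟨P, h₁, h₂, h₃, -⟩ := hV.exists_automorphicRepData_of_mem hφ hφ0
  exact ⟨P, h₁, h₂, h₃⟩

end General

/-! ### 2. Hecke eigenvectors exhibit Satake parameters (`GL_n`) -/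

section GLn

variable {n : ℕ} {K : Type} [Field K] [NumberField K] {hcpt : isCompact_glFiniteIntegralLevel n K}

/-- **A genuine Hecke eigenvector exhibits a Satake parameter.** If `φ ∈ W ∖ W'` is fixed by the
principal congruence subgroup `K(𝔫)`, `𝔫 ≠ 0` prime to `v`, and is an eigenvector of the Hecke
operators `[K(𝔫) t_{v,i} K(𝔫)]`, `i ≤ n` (`t_{v,i} = diag(ϖ,…,ϖ,1,…,1)`, `ϖ` a uniformizer at
`v`), with the eigenvalues `q_v^{i(n-i)/2} e_i(α)` of a multiset `α` of `n` complex numbers, then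
`π = W / W'` has Satake parameter `α` at `v` (an eigenvector is an eigenvector modulo `W'`;
Satake–Tamagawa normalisation of `AutomorphicRepData.HasSatakeParamAt`; Bump, *Automorphic Forms
and Representations*, §3.3; Borel–Jacquet 1979, 4.6). [cite: BorelJacquet1979, 4.6] -/
theorem AutomorphicRepData.hasSatakeParamAt_of_eigenvector
    (π : AutomorphicRepData (AutomorphyDatum.gl n K hcpt)) {v : HeightOneSpectrum (𝓞 K)}
    {α : Multiset ℂ} {𝔫 : Ideal (𝓞 K)} {ϖ : (v.adicCompletion K)ˣ}
    (h𝔫 : 𝔫 ≠ 0) (hv : ¬ v.asIdeal ∣ 𝔫)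
    (hϖ : Valued.v (ϖ : v.adicCompletion K) = WithZero.exp (-1 : ℤ)) (hα : Multiset.card α = n)
    {φ : (AdelicGroupData.gl n K).Adelic → ℂ} (hφ : φ ∈ π.W) (hφ' : φ ∉ π.W')
    (hfix : ∀ u ∈ principalCongruenceLevel n K 𝔫, rightTranslation (AdelicGroupData.gl n K) u φ = φ)
    (heig : ∀ i ≤ n, heckeOperator (rightTranslation (AdelicGroupData.gl n K))
        (principalCongruenceLevel n K 𝔫) (heckeDiagAt n K v ϖ i) φ =
      ((((Real.sqrt (v.residueCard : ℝ)) : ℝ) : ℂ) ^ (i * (n - i)) * α.esymm i) • φ) :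
    π.HasSatakeParamAt v α := by
  refine ⟨𝔫, ϖ, h𝔫, hv, hϖ, hα, φ, hφ, hφ', hfix, fun i hi => ?_⟩
  rw [heig i hi, sub_self]
  exact π.W'.zero_mem

/-- **From an eigenform to an automorphic representation with its Satake parameters** (`GL_n`;
Borel–Jacquet 1979, 4.6 with Langlands 1979, Prop. 2). Let `V` be a stable space of automorphic
forms on `GL_n(𝔸_K)` and `0 ≠ φ ∈ V` invariant under `K(𝔫)`, `𝔫 ≠ 0`. Then there is ONE
automorphic representation datum `P` with `φ ∈ P.W ∖ P.W'`, `P.W ≤ V`, such that at every finite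
place `v ∤ 𝔫`, for every uniformizer `ϖ` and every multiset `α` of `n` numbers: if `φ` is an
eigenvector of the `[K(𝔫) t_{v,i} K(𝔫)]`, `i ≤ n`, with eigenvalues `q_v^{i(n-i)/2} e_i(α)`, then
`P` has Satake parameter `α` at `v`. [cite: BorelJacquet1979, 4.6] -/
theorem IsStableSubmodule.exists_automorphicRepData_hasSatakeParamAt_of_eigenvector
    {V : Submodule ℂ ((AdelicGroupData.gl n K).Adelic → ℂ)}
    (hV : IsStableSubmodule (AutomorphyDatum.gl n K hcpt) V)
    {φ : (AdelicGroupData.gl n K).Adelic → ℂ} (hφ : φ ∈ V) (hφ0 : φ ≠ 0)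
    {𝔫 : Ideal (𝓞 K)} (h𝔫 : 𝔫 ≠ 0)
    (hfix : ∀ u ∈ principalCongruenceLevel n K 𝔫, rightTranslation (AdelicGroupData.gl n K) u φ = φ) :
    ∃ P : AutomorphicRepData (AutomorphyDatum.gl n K hcpt), φ ∈ P.W ∧ φ ∉ P.W' ∧ P.W ≤ V ∧
      ∀ (v : HeightOneSpectrum (𝓞 K)), ¬ v.asIdeal ∣ 𝔫 →
        ∀ (ϖ : (v.adicCompletion K)ˣ) (α : Multiset ℂ),
          Valued.v (ϖ : v.adicCompletion K) = WithZero.exp (-1 : ℤ) → Multiset.card α = n →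
          (∀ i ≤ n, heckeOperator (rightTranslation (AdelicGroupData.gl n K))
              (principalCongruenceLevel n K 𝔫) (heckeDiagAt n K v ϖ i) φ =
            ((((Real.sqrt (v.residueCard : ℝ)) : ℝ) : ℂ) ^ (i * (n - i)) * α.esymm i) • φ) →
          P.HasSatakeParamAt v α := by
  obtain ⟨P, hφW, hφW', hle⟩ := hV.exists_automorphicRepData_mem_not_mem hφ hφ0
  exact ⟨P, hφW, hφW', hle, fun v hv ϖ α hϖ hα heig =>
    P.hasSatakeParamAt_of_eigenvector h𝔫 hv hϖ hα hφW hφW' hfix heig⟩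

end GLn

/-! ### 3. The first clause of Kim's Theorem A from an eigenform on `GL₆` -/

section Kim

/-- `∧²` of a `GL₄` Satake parameter has `6` entries. [folklore] -/
theorem card_wedgeTwoParams_of_card_eq_four {α : Multiset ℂ} (hα : Multiset.card α = 4) :
    Multiset.card (wedgeTwoParams α) = 6 := by
  rw [card_wedgeTwoParams, hα]
  rfl

/-- **Kim's Theorem A, first clause, from an eigenform** (packaging half of the discharge of
`Kim2003_exteriorSquare_GL4`; Kim 2003, Thm. 4.2.3, p. 156, with Borel–Jacquet 1979, 4.6). Let
`π` be a cuspidal datum on `GL₄(𝔸_F)`. Suppose some stable space `V` of automorphic forms on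
`GL₆(𝔸_F)` contains a non-zero form `φ`, invariant under a principal congruence subgroup `K(𝔫)`
(`𝔫 ≠ 0`), such that for almost every finite place `v`: whenever `π` has Satake parameter `α`
at `v`, `φ` is an eigenvector of the Hecke operators `[K(𝔫) t_{v,i} K(𝔫)]`, `i ≤ 6`, for some
uniformizer `ϖ_v`, with the eigenvalues `q_v^{i(6-i)/2} e_i(∧²α)` — i.e. `φ` is a Hecke
eigenform with the eigenvalues of `∧²π`. Then the automorphic representation generated by `φ`
is a weak exterior square lift of `π` in the sense of the fact: `P.HasSatakeParamAt v (∧²α)` for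
almost all `v`. (The existence of such a `φ` is the analytic content of Kim's theorem — converse
theorem and Langlands–Shahidi method, §§2–4 — and is NOT proved here.)
[cite: Kim2002, Thm. 4.2.3 (p. 156); packaging by BorelJacquet1979, 4.6] -/
theorem Kim2003_exteriorSquare_GL4.clause_one_of_eigenform
    (F : Type) [Field F] [NumberField F] (hF : ∀ m : ℕ, isCompact_glFiniteIntegralLevel m F)
    (π : CuspidalAutomorphicRepData 4 F (hF 4))
    {V : Submodule ℂ ((AdelicGroupData.gl 6 F).Adelic → ℂ)}
    (hV : IsStableSubmodule (AutomorphyDatum.gl 6 F (hF 6)) V)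
    {φ : (AdelicGroupData.gl 6 F).Adelic → ℂ} (hφ : φ ∈ V) (hφ0 : φ ≠ 0)
    {𝔫 : Ideal (𝓞 F)} (h𝔫 : 𝔫 ≠ 0)
    (hfix : ∀ u ∈ principalCongruenceLevel 6 F 𝔫, rightTranslation (AdelicGroupData.gl 6 F) u φ = φ)
    (heig : ∀ᶠ v : HeightOneSpectrum (𝓞 F) in cofinite, ∀ α : Multiset ℂ,
      π.1.HasSatakeParamAt v α →
        ∃ ϖ : (v.adicCompletion F)ˣ, Valued.v (ϖ : v.adicCompletion F) = WithZero.exp (-1 : ℤ) ∧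
          ∀ i ≤ 6, heckeOperator (rightTranslation (AdelicGroupData.gl 6 F))
              (principalCongruenceLevel 6 F 𝔫) (heckeDiagAt 6 F v ϖ i) φ =
            ((((Real.sqrt (v.residueCard : ℝ)) : ℝ) : ℂ) ^ (i * (6 - i)) *
              (wedgeTwoParams α).esymm i) • φ) :
    ∃ P : AutomorphicRepData (AutomorphyDatum.gl 6 F (hF 6)), φ ∈ P.W ∧ φ ∉ P.W' ∧ P.W ≤ V ∧
      ∀ᶠ v : HeightOneSpectrum (𝓞 F) in cofinite, ∀ α : Multiset ℂ,
        π.1.HasSatakeParamAt v α → P.HasSatakeParamAt v (wedgeTwoParams α) := by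
  obtain ⟨P, hφW, hφW', hle, hP⟩ :=
    hV.exists_automorphicRepData_hasSatakeParamAt_of_eigenvector hφ hφ0 h𝔫 hfix
  refine ⟨P, hφW, hφW', hle, ?_⟩
  filter_upwards [heig, (Ideal.finite_factors h𝔫).compl_mem_cofinite] with v hv hv𝔫 α hα
  obtain ⟨ϖ, hϖ, he⟩ := hv α hα
  exact hP v hv𝔫 ϖ _ hϖ (card_wedgeTwoParams_of_card_eq_four hα.card_eq) he

/-- **Both clauses of Kim's Theorem A from a cuspidal eigenform** (the case "`∧²π` cuspidal":
Kim 2003, Thm. 4.2.3 p. 156 with `k = 1`; packaging by Borel–Jacquet 1979, 4.6). If a stable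
space `V` of **cusp** forms on `GL₆(𝔸_F)` (`V ≤ 𝒜₀ = cuspFormsGL`) contains a non-zero
`K(𝔫)`-invariant form `φ` which, at almost every `v`, is a Hecke eigenform with the eigenvalues
`q_v^{i(6-i)/2} e_i(∧²α)` whenever `π` has Satake parameter `α` at `v`, then the conclusion of
`Kim2003_exteriorSquare_GL4` holds for `π` in full: the automorphic representation `P` generated by
`φ` is cuspidal (`P.W ≤ V ≤ 𝒜₀`), clause (i) is `clause_one_of_eigenform`, and the isobaric clause
(ii) holds with the one-term family `σ₁ = P` (`∑_{i : Fin 1} βᵢ = β₁`). The existence of such a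
cusp form is NOT proved here. [cite: Kim2002, Thm. 4.2.3 (p. 156)] -/
theorem Kim2003_exteriorSquare_GL4.conclusion_of_cuspidal_eigenform
    (F : Type) [Field F] [NumberField F] (hF : ∀ m : ℕ, isCompact_glFiniteIntegralLevel m F)
    (π : CuspidalAutomorphicRepData 4 F (hF 4))
    {V : Submodule ℂ ((AdelicGroupData.gl 6 F).Adelic → ℂ)}
    (hV : IsStableSubmodule (AutomorphyDatum.gl 6 F (hF 6)) V) (hV₀ : V ≤ cuspFormsGL 6 F (hF 6))
    {φ : (AdelicGroupData.gl 6 F).Adelic → ℂ} (hφ : φ ∈ V) (hφ0 : φ ≠ 0)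
    {𝔫 : Ideal (𝓞 F)} (h𝔫 : 𝔫 ≠ 0)
    (hfix : ∀ u ∈ principalCongruenceLevel 6 F 𝔫, rightTranslation (AdelicGroupData.gl 6 F) u φ = φ)
    (heig : ∀ᶠ v : HeightOneSpectrum (𝓞 F) in cofinite, ∀ α : Multiset ℂ,
      π.1.HasSatakeParamAt v α →
        ∃ ϖ : (v.adicCompletion F)ˣ, Valued.v (ϖ : v.adicCompletion F) = WithZero.exp (-1 : ℤ) ∧
          ∀ i ≤ 6, heckeOperator (rightTranslation (AdelicGroupData.gl 6 F))
              (principalCongruenceLevel 6 F 𝔫) (heckeDiagAt 6 F v ϖ i) φ =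
            ((((Real.sqrt (v.residueCard : ℝ)) : ℝ) : ℂ) ^ (i * (6 - i)) *
              (wedgeTwoParams α).esymm i) • φ) :
    ∃ P : AutomorphicRepData (AutomorphyDatum.gl 6 F (hF 6)),
      (∀ᶠ v : HeightOneSpectrum (𝓞 F) in cofinite, ∀ α : Multiset ℂ,
        π.1.HasSatakeParamAt v α → P.HasSatakeParamAt v (wedgeTwoParams α)) ∧
      ∃ (k : ℕ) (m : Fin k → ℕ) (σ : ∀ i : Fin k, CuspidalAutomorphicRepData (m i) F (hF (m i))),
        (∑ i, m i = 6) ∧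
        ∀ᶠ v : HeightOneSpectrum (𝓞 F) in cofinite, ∀ β : Fin k → Multiset ℂ,
          (∀ i, (σ i).1.HasSatakeParamAt v (β i)) → P.HasSatakeParamAt v (∑ i, β i) := by
  obtain ⟨P, -, -, hle, hP⟩ :=
    Kim2003_exteriorSquare_GL4.clause_one_of_eigenform F hF π hV hφ hφ0 h𝔫 hfix heig
  refine ⟨P, hP, 1, fun _ => 6, fun _ => ⟨P, hle.trans hV₀⟩, by simp, ?_⟩
  refine Filter.Eventually.of_forall fun v β hβ => ?_
  simpa only [Fin.sum_univ_one] using hβ 0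

end Kim

end Literature.NumberTheory.Automorphic

end
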